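import Summits.Parity.BatemanHorn.Theorems.RoughParitySectorsRoughCountBand

/-!
# Route `RoughParitySectors`, crux `OddSectorShareNonlinear` (stmt-Parity-15628): the crux in
# BATEMAN–HORN / PARITY COORDINATES (no convergence hypothesis) — by the line lead (c3)

Everything here is PROVED (no `sorry`, no new definition, no new fact); it supports the crux
`OddSectorShareNonlinear` without closing it.

For a Bateman–Horn system `f` (`IsBatemanHornSystem f`, any `k`), depth `U` and `x` write
`R = #R_f(x,U)` (jointly rough set, thresholds `x^{deg fᵢ/U}`), `c₁` (prime cell), `c_odd` (all-odd
`Ω`-sector), `m = C(f)/∏ deg fᵢ`, `L = (log x)^k`.  The crux asserts, for systems with a member of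
degree `≥ 2`, the SHARE statement

  `A_f :  ∀ η > 0 ∃ U₀ ∀ U ≥ U₀ ∀ᶠ x,  |c₁·(U e^{−γ}/2)^k − c_odd| ≤ η·c_odd`.

This file proves that, system by system and using ONLY the proved band of the route
(`Theorems.RoughCountBand.roughCard_calibration`: `|R·L − x·m·e^{−kγ}U^k| ≤ τ·x·m·e^{−kγ}U^k` for
`U ≥ U₀(τ)`, eventually), `A_f` is EQUIVALENT to the COORDINATE statement

  `D_f :  ∀ ε > 0 ∃ U₀ ∀ U ≥ U₀ ∀ᶠ x,  |c₁·L·R − 2^k·c_odd·(m·x)| ≤ ε·(2^k·c_odd·(m·x))`,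

i.e. "the Bateman–Horn ratio `c₁·(log x)^k/(m·x)` of `f` and the all-odd-sector density ratio
`2^k·c_odd/R` of its jointly rough values AGREE in the iterated limit" — with NEITHER ratio asserted to
converge, and with the Buchstab–Mertens constant `(U e^{−γ}/2)^k` of the crux eliminated (it is
absorbed by the band: `2^k·(U e^{−γ}/2)^k = e^{−kγ}U^k`, `two_pow_mul_shareBase_pow`).

* `Coordinates.coordinates_of_share` — `A_f ⟹ D_f`;
* `Coordinates.share_of_coordinates` — `D_f ⟹ A_f`;
* `Coordinates.share_iff_coordinates` — `A_f ↔ D_f`;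
* `oddSectorShareNonlinear_iff_coordinates` — the crux BY NAME `↔ ∀` nonlinear Bateman–Horn systems
  `f`, `D_f`; `oddSectorShareLinear_iff_coordinates` — the all-linear twin.

So the crux says EXACTLY: along every nonlinear system any deviation of the prime count from
Bateman–Horn is mirrored by an equal relative bias of the parity sectors of the rough values, and
conversely ("BH-defect = parity-defect", uniformly as `U → ∞`).  The three "two-out-of-three"
theorems of `…Exactness` / `…PerSystem` (any two of {`BatemanHornAsymptotic f`, parity balance
`P_f : 2^k c_odd = R(1 ± δ)`, `A_f`} give the third) are immediate corollaries of this form, since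
`BatemanHornAsymptotic f` is `c₁·L/(m·x) → 1` (`primeCell_calibration`) and `P_f` is `2^k c_odd/R → 1`.
Nothing here advances the crux: it is a certificate of what the crux IS.

References: Bateman–Horn, Math. Comp. 16 (1962) (1)–(2) [BatemanHorn1962]; K. Alladi, Quart. J.
Math. 33 (1982) [Alladi1982]; Halberstam–Richert, *Sieve Methods* (1974), Thm 2.5
[HalberstamRichert1974].
-/

namespace Summit.Parity.BatemanHorn.Cruxes.OddSectorShareNonlinear.Birth

open Filter Finset Polynomial
open scoped Topology
open Literature.NumberTheory.Sieve
open Summit.Parity.BatemanHorn.Theorems.RoughCountBand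

namespace Coordinates

/-! ### §1 Real arithmetic: the two squeezes -/

/-- Share band `|c₁·Ak − co| ≤ η·co` and count band `|RL − K·Ak| ≤ τ·K·Ak` give the coordinate band
`|c₁·RL − K·co| ≤ ε·K·co` as soon as `τ + η + τη ≤ ε` (`c₁, co ≥ 0`, `K > 0`, `τ ≤ 1`).
[folklore] -/
theorem coord_of_share_arith {c₁ co RL K Ak η τ ε : ℝ} (hc₁ : 0 ≤ c₁) (hco : 0 ≤ co)
    (hK : 0 < K) (hη : 0 ≤ η) (hτ0 : 0 ≤ τ) (hτ1 : τ ≤ 1)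
    (h1 : |c₁ * Ak - co| ≤ η * co) (h2 : |RL - K * Ak| ≤ τ * (K * Ak))
    (hε : τ + η + τ * η ≤ ε) : |c₁ * RL - K * co| ≤ ε * (K * co) := by
  obtain ⟨h1a, h1b⟩ := abs_le.1 h1
  obtain ⟨h2a, h2b⟩ := abs_le.1 h2
  -- `(1-η) co ≤ c₁ Ak ≤ (1+η) co` and `(1-τ) K Ak ≤ RL ≤ (1+τ) K Ak`
  have hA_hi : c₁ * Ak ≤ (1 + η) * co := by linarith
  have hA_lo : (1 - η) * co ≤ c₁ * Ak := by linarith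
  have hR_hi : RL ≤ (1 + τ) * (K * Ak) := by linarith
  have hR_lo : (1 - τ) * (K * Ak) ≤ RL := by linarith
  -- multiply the count band by `c₁ ≥ 0`, then insert the share band (factors `(1±τ)K ≥ 0`)
  have hup : c₁ * RL ≤ (1 + τ) * K * ((1 + η) * co) := by
    have s1 : c₁ * RL ≤ c₁ * ((1 + τ) * (K * Ak)) := mul_le_mul_of_nonneg_left hR_hi hc₁
    have s2 : (1 + τ) * K * (c₁ * Ak) ≤ (1 + τ) * K * ((1 + η) * co) :=
      mul_le_mul_of_nonneg_left hA_hi (by positivity)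
    calc c₁ * RL ≤ c₁ * ((1 + τ) * (K * Ak)) := s1
      _ = (1 + τ) * K * (c₁ * Ak) := by ring
      _ ≤ (1 + τ) * K * ((1 + η) * co) := s2
  have hlo : (1 - τ) * K * ((1 - η) * co) ≤ c₁ * RL := by
    have s1 : c₁ * ((1 - τ) * (K * Ak)) ≤ c₁ * RL := mul_le_mul_of_nonneg_left hR_lo hc₁
    have s2 : (1 - τ) * K * ((1 - η) * co) ≤ (1 - τ) * K * (c₁ * Ak) :=
      mul_le_mul_of_nonneg_left hA_lo (mul_nonneg (by linarith) hK.le)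
    calc (1 - τ) * K * ((1 - η) * co) ≤ (1 - τ) * K * (c₁ * Ak) := s2
      _ = c₁ * ((1 - τ) * (K * Ak)) := by ring
      _ ≤ c₁ * RL := s1
  have hKco : 0 ≤ K * co := mul_nonneg hK.le hco
  have hτη : 0 ≤ τ * η * (K * co) := mul_nonneg (mul_nonneg hτ0 hη) hKco
  have hεK : (τ + η + τ * η) * (K * co) ≤ ε * (K * co) := mul_le_mul_of_nonneg_right hε hKco
  rw [abs_le]
  constructor
  · -- `K co − c₁ RL ≤ (τ + η − τη) K co ≤ ε K co`
    have e : (1 - τ) * K * ((1 - η) * co) = K * co - (τ + η - τ * η) * (K * co) := by ring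
    nlinarith
  · have e : (1 + τ) * K * ((1 + η) * co) = K * co + (τ + η + τ * η) * (K * co) := by ring
    nlinarith

/-- Coordinate band `|c₁·RL − K·co| ≤ ε·K·co` and count band `|RL − K·Ak| ≤ τ·K·Ak` give the share
band `|c₁·Ak − co| ≤ η·co` as soon as `1 + ε ≤ (1+η)(1−τ)` and `(1−η)(1+τ) ≤ 1 − ε`
(`c₁, co ≥ 0`, `K > 0`, `0 ≤ τ < 1`). [folklore] -/
theorem share_of_coord_arith {c₁ co RL K Ak η τ ε : ℝ} (hc₁ : 0 ≤ c₁) (hco : 0 ≤ co)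
    (hK : 0 < K) (hτ0 : 0 ≤ τ) (hτ1 : τ < 1)
    (h1 : |c₁ * RL - K * co| ≤ ε * (K * co)) (h2 : |RL - K * Ak| ≤ τ * (K * Ak))
    (hup : 1 + ε ≤ (1 + η) * (1 - τ)) (hlo : (1 - η) * (1 + τ) ≤ 1 - ε) :
    |c₁ * Ak - co| ≤ η * co := by
  obtain ⟨h1a, h1b⟩ := abs_le.1 h1
  obtain ⟨h2a, h2b⟩ := abs_le.1 h2
  have hR_hi : RL ≤ (1 + τ) * (K * Ak) := by linarith
  have hR_lo : (1 - τ) * (K * Ak) ≤ RL := by linarith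
  have hC_hi : c₁ * RL ≤ (1 + ε) * (K * co) := by linarith
  have hC_lo : (1 - ε) * (K * co) ≤ c₁ * RL := by linarith
  have hKco : 0 ≤ K * co := mul_nonneg hK.le hco
  -- upper: `(1-τ) K (c₁ Ak) ≤ c₁ RL ≤ (1+ε) K co ≤ (1+η)(1-τ) K co`
  have hU : ((1 - τ) * K) * (c₁ * Ak) ≤ ((1 - τ) * K) * ((1 + η) * co) := by
    have s1 : c₁ * ((1 - τ) * (K * Ak)) ≤ c₁ * RL := mul_le_mul_of_nonneg_left hR_lo hc₁
    have s2 : (1 + ε) * (K * co) ≤ (1 + η) * (1 - τ) * (K * co) :=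
      mul_le_mul_of_nonneg_right hup hKco
    calc ((1 - τ) * K) * (c₁ * Ak) = c₁ * ((1 - τ) * (K * Ak)) := by ring
      _ ≤ c₁ * RL := s1
      _ ≤ (1 + ε) * (K * co) := hC_hi
      _ ≤ (1 + η) * (1 - τ) * (K * co) := s2
      _ = ((1 - τ) * K) * ((1 + η) * co) := by ring
  have hU' : c₁ * Ak ≤ (1 + η) * co :=
    le_of_mul_le_mul_left hU (mul_pos (by linarith) hK)
  -- lower: `(1+τ) K (c₁ Ak) ≥ c₁ RL ≥ (1-ε) K co ≥ (1-η)(1+τ) K co`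
  have hL : ((1 + τ) * K) * ((1 - η) * co) ≤ ((1 + τ) * K) * (c₁ * Ak) := by
    have s1 : c₁ * RL ≤ c₁ * ((1 + τ) * (K * Ak)) := mul_le_mul_of_nonneg_left hR_hi hc₁
    have s2 : (1 - η) * (1 + τ) * (K * co) ≤ (1 - ε) * (K * co) :=
      mul_le_mul_of_nonneg_right hlo hKco
    calc ((1 + τ) * K) * ((1 - η) * co) = (1 - η) * (1 + τ) * (K * co) := by ring
      _ ≤ (1 - ε) * (K * co) := s2
      _ ≤ c₁ * RL := hC_lo
      _ ≤ c₁ * ((1 + τ) * (K * Ak)) := s1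
      _ = ((1 + τ) * K) * (c₁ * Ak) := by ring
  have hL' : (1 - η) * co ≤ c₁ * Ak :=
    le_of_mul_le_mul_left hL (mul_pos (by linarith) hK)
  rw [abs_le]
  constructor <;> linarith

/-! ### §2 `A_f ↔ D_f`, system by system -/

/-- **`A_f ⟹ D_f`.**  For a Bateman–Horn system `f`, the odd-sector share statement
(`|c₁·(U e^{−γ}/2)^k − c_odd| ≤ η·c_odd` for `U ≥ U₀(η)`, eventually in `x` — the conclusion of
`OddSectorShareNonlinear` / `OddSectorShareLinear` for `f`) implies the coordinate statement
`|c₁·(log x)^k·#R − 2^k·c_odd·(m·x)| ≤ ε·2^k·c_odd·(m·x)` for `U ≥ U₀(ε)`, eventually in `x`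
(`m = C(f)/∏deg fᵢ`): the Bateman–Horn ratio of `f` equals the parity ratio of its rough values.
Squeeze through `roughCard_calibration` with `τ = η = min(ε,1)/3`. [folklore] -/
theorem coordinates_of_share {k : ℕ} {f : Fin k → ℤ[X]} (hf : IsBatemanHornSystem f)
    (hA : ∀ η : ℝ, 0 < η → ∃ U₀ : ℝ, ∀ U : ℝ, U₀ ≤ U → ∀ᶠ x : ℕ in Filter.atTop,
      |(((((Finset.Icc 1 x).filter (fun n : ℕ => ∀ i, 0 < (f i).eval (n : ℤ) ∧
          ∀ p ∈ Finset.range ⌈(x : ℝ) ^ (((f i).natDegree : ℝ) / U)⌉₊, p.Prime →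
            ¬ ((p : ℤ) ∣ (f i).eval (n : ℤ)))).filter (fun n : ℕ => ∀ i,
          ArithmeticFunction.cardFactors (((f i).eval (n : ℤ)).toNat) = 1)).card : ℕ) : ℝ) *
          (U * Real.exp (-Real.eulerMascheroniConstant) / 2) ^ k -
        (((((Finset.Icc 1 x).filter (fun n : ℕ => ∀ i, 0 < (f i).eval (n : ℤ) ∧
          ∀ p ∈ Finset.range ⌈(x : ℝ) ^ (((f i).natDegree : ℝ) / U)⌉₊, p.Prime →
            ¬ ((p : ℤ) ∣ (f i).eval (n : ℤ)))).filter (fun n : ℕ => ∀ i,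
          Odd (ArithmeticFunction.cardFactors (((f i).eval (n : ℤ)).toNat)))).card : ℕ) : ℝ)| ≤
        η * (((((Finset.Icc 1 x).filter (fun n : ℕ => ∀ i, 0 < (f i).eval (n : ℤ) ∧
          ∀ p ∈ Finset.range ⌈(x : ℝ) ^ (((f i).natDegree : ℝ) / U)⌉₊, p.Prime →
            ¬ ((p : ℤ) ∣ (f i).eval (n : ℤ)))).filter (fun n : ℕ => ∀ i,
          Odd (ArithmeticFunction.cardFactors (((f i).eval (n : ℤ)).toNat)))).card : ℕ) : ℝ)) :
    ∀ ε : ℝ, 0 < ε → ∃ U₀ : ℝ, ∀ U : ℝ, U₀ ≤ U → ∀ᶠ x : ℕ in Filter.atTop,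
      |(((((Finset.Icc 1 x).filter (fun n : ℕ => ∀ i, 0 < (f i).eval (n : ℤ) ∧
          ∀ p ∈ Finset.range ⌈(x : ℝ) ^ (((f i).natDegree : ℝ) / U)⌉₊, p.Prime →
            ¬ ((p : ℤ) ∣ (f i).eval (n : ℤ)))).filter (fun n : ℕ => ∀ i,
          ArithmeticFunction.cardFactors (((f i).eval (n : ℤ)).toNat) = 1)).card : ℕ) : ℝ) *
          Real.log x ^ k *
          ((((Finset.Icc 1 x).filter (fun n : ℕ => ∀ i, 0 < (f i).eval (n : ℤ) ∧
            ∀ p ∈ Finset.range ⌈(x : ℝ) ^ (((f i).natDegree : ℝ) / U)⌉₊, p.Prime →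
              ¬ ((p : ℤ) ∣ (f i).eval (n : ℤ)))).card : ℕ) : ℝ) -
        (2 : ℝ) ^ k * (((((Finset.Icc 1 x).filter (fun n : ℕ => ∀ i, 0 < (f i).eval (n : ℤ) ∧
          ∀ p ∈ Finset.range ⌈(x : ℝ) ^ (((f i).natDegree : ℝ) / U)⌉₊, p.Prime →
            ¬ ((p : ℤ) ∣ (f i).eval (n : ℤ)))).filter (fun n : ℕ => ∀ i,
          Odd (ArithmeticFunction.cardFactors (((f i).eval (n : ℤ)).toNat)))).card : ℕ) : ℝ) *
          (batemanHornConst f / (∏ i, ((f i).natDegree : ℝ)) * x)| ≤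
        ε * ((2 : ℝ) ^ k * (((((Finset.Icc 1 x).filter (fun n : ℕ => ∀ i, 0 < (f i).eval (n : ℤ) ∧
          ∀ p ∈ Finset.range ⌈(x : ℝ) ^ (((f i).natDegree : ℝ) / U)⌉₊, p.Prime →
            ¬ ((p : ℤ) ∣ (f i).eval (n : ℤ)))).filter (fun n : ℕ => ∀ i,
          Odd (ArithmeticFunction.cardFactors (((f i).eval (n : ℤ)).toNat)))).card : ℕ) : ℝ) *
          (batemanHornConst f / (∏ i, ((f i).natDegree : ℝ)) * x)) := by
  intro ε hε
  obtain ⟨_, hC0⟩ := IsBatemanHornSystem.hasBatemanHornConst_holds hf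
  set m : ℝ := batemanHornConst f / ∏ i, ((f i).natDegree : ℝ) with hm
  have hm0 : 0 < m := div_pos hC0 (prod_pos fun i _ => by exact_mod_cast hf.natDegree_pos i)
  -- the common tolerance `τ = η = ε'/3`, `ε' = min ε 1`
  set τ : ℝ := min ε 1 / 3 with hτ
  have hτ0 : 0 < τ := by positivity
  have hτ1 : τ ≤ 1 / 3 := by rw [hτ]; linarith [min_le_right ε 1]
  have hτε : τ + τ + τ * τ ≤ ε := by
    have h3 : 3 * τ ≤ ε := by rw [hτ]; linarith [min_le_left ε 1]
    nlinarith
  obtain ⟨U_R, hR⟩ := roughCard_calibration hf τ hτ0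
  obtain ⟨U_A, hAU⟩ := hA τ hτ0
  refine ⟨max (max U_R U_A) 1, fun U hU => ?_⟩
  have hUR : U_R ≤ U := le_trans (le_trans (le_max_left _ _) (le_max_left _ _)) hU
  have hUA : U_A ≤ U := le_trans (le_trans (le_max_right _ _) (le_max_left _ _)) hU
  have hU0 : 0 < U := by linarith [le_trans (le_max_right _ _) hU]
  filter_upwards [hR U hUR, hAU U hUA, eventually_ge_atTop 2] with x h2 h1 hx2
  have hX : (0 : ℝ) < x := by exact_mod_cast (by omega : 0 < x)
  have hK : (0 : ℝ) < 2 ^ k * (m * x) := by positivity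
  have hid : (x : ℝ) * (m * Real.exp (-((k : ℝ) * Real.eulerMascheroniConstant)) * U ^ k) =
      2 ^ k * (m * x) * (U * Real.exp (-Real.eulerMascheroniConstant) / 2) ^ k := by
    have h := two_pow_mul_shareBase_pow k U
    calc (x : ℝ) * (m * Real.exp (-((k : ℝ) * Real.eulerMascheroniConstant)) * U ^ k)
        = x * m * (Real.exp (-((k : ℝ) * Real.eulerMascheroniConstant)) * U ^ k) := by ring
      _ = x * m * ((2 : ℝ) ^ k * (U * Real.exp (-Real.eulerMascheroniConstant) / 2) ^ k) := by
          rw [h]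
      _ = 2 ^ k * (m * x) * (U * Real.exp (-Real.eulerMascheroniConstant) / 2) ^ k := by ring
  rw [hid] at h2
  have key := coord_of_share_arith (Nat.cast_nonneg _) (Nat.cast_nonneg _) hK hτ0.le hτ0.le
    (by linarith) h1 h2 hτε
  -- reshape `c₁ * (R * L)` / `K * co` into the displayed products
  convert key using 2 <;> ring

/-- **`D_f ⟹ A_f`.**  For a Bateman–Horn system `f`, the coordinate statement
(`|c₁·(log x)^k·#R − 2^k·c_odd·(m·x)| ≤ ε·2^k·c_odd·(m·x)` for `U ≥ U₀(ε)`, eventually in `x`)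
implies the odd-sector share statement `|c₁·(U e^{−γ}/2)^k − c_odd| ≤ η·c_odd` for `U ≥ U₀(η)`,
eventually in `x` (the conclusion of `OddSectorShareNonlinear` / `OddSectorShareLinear` for `f`).
Squeeze through `roughCard_calibration` with `τ = ε = min(η,1)/3`. [folklore] -/
theorem share_of_coordinates {k : ℕ} {f : Fin k → ℤ[X]} (hf : IsBatemanHornSystem f)
    (hD : ∀ ε : ℝ, 0 < ε → ∃ U₀ : ℝ, ∀ U : ℝ, U₀ ≤ U → ∀ᶠ x : ℕ in Filter.atTop,
      |(((((Finset.Icc 1 x).filter (fun n : ℕ => ∀ i, 0 < (f i).eval (n : ℤ) ∧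
          ∀ p ∈ Finset.range ⌈(x : ℝ) ^ (((f i).natDegree : ℝ) / U)⌉₊, p.Prime →
            ¬ ((p : ℤ) ∣ (f i).eval (n : ℤ)))).filter (fun n : ℕ => ∀ i,
          ArithmeticFunction.cardFactors (((f i).eval (n : ℤ)).toNat) = 1)).card : ℕ) : ℝ) *
          Real.log x ^ k *
          ((((Finset.Icc 1 x).filter (fun n : ℕ => ∀ i, 0 < (f i).eval (n : ℤ) ∧
            ∀ p ∈ Finset.range ⌈(x : ℝ) ^ (((f i).natDegree : ℝ) / U)⌉₊, p.Prime →
              ¬ ((p : ℤ) ∣ (f i).eval (n : ℤ)))).card : ℕ) : ℝ) -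
        (2 : ℝ) ^ k * (((((Finset.Icc 1 x).filter (fun n : ℕ => ∀ i, 0 < (f i).eval (n : ℤ) ∧
          ∀ p ∈ Finset.range ⌈(x : ℝ) ^ (((f i).natDegree : ℝ) / U)⌉₊, p.Prime →
            ¬ ((p : ℤ) ∣ (f i).eval (n : ℤ)))).filter (fun n : ℕ => ∀ i,
          Odd (ArithmeticFunction.cardFactors (((f i).eval (n : ℤ)).toNat)))).card : ℕ) : ℝ) *
          (batemanHornConst f / (∏ i, ((f i).natDegree : ℝ)) * x)| ≤
        ε * ((2 : ℝ) ^ k * (((((Finset.Icc 1 x).filter (fun n : ℕ => ∀ i, 0 < (f i).eval (n : ℤ) ∧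
          ∀ p ∈ Finset.range ⌈(x : ℝ) ^ (((f i).natDegree : ℝ) / U)⌉₊, p.Prime →
            ¬ ((p : ℤ) ∣ (f i).eval (n : ℤ)))).filter (fun n : ℕ => ∀ i,
          Odd (ArithmeticFunction.cardFactors (((f i).eval (n : ℤ)).toNat)))).card : ℕ) : ℝ) *
          (batemanHornConst f / (∏ i, ((f i).natDegree : ℝ)) * x))) :
    ∀ η : ℝ, 0 < η → ∃ U₀ : ℝ, ∀ U : ℝ, U₀ ≤ U → ∀ᶠ x : ℕ in Filter.atTop,
      |(((((Finset.Icc 1 x).filter (fun n : ℕ => ∀ i, 0 < (f i).eval (n : ℤ) ∧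
          ∀ p ∈ Finset.range ⌈(x : ℝ) ^ (((f i).natDegree : ℝ) / U)⌉₊, p.Prime →
            ¬ ((p : ℤ) ∣ (f i).eval (n : ℤ)))).filter (fun n : ℕ => ∀ i,
          ArithmeticFunction.cardFactors (((f i).eval (n : ℤ)).toNat) = 1)).card : ℕ) : ℝ) *
          (U * Real.exp (-Real.eulerMascheroniConstant) / 2) ^ k -
        (((((Finset.Icc 1 x).filter (fun n : ℕ => ∀ i, 0 < (f i).eval (n : ℤ) ∧
          ∀ p ∈ Finset.range ⌈(x : ℝ) ^ (((f i).natDegree : ℝ) / U)⌉₊, p.Prime →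
            ¬ ((p : ℤ) ∣ (f i).eval (n : ℤ)))).filter (fun n : ℕ => ∀ i,
          Odd (ArithmeticFunction.cardFactors (((f i).eval (n : ℤ)).toNat)))).card : ℕ) : ℝ)| ≤
        η * (((((Finset.Icc 1 x).filter (fun n : ℕ => ∀ i, 0 < (f i).eval (n : ℤ) ∧
          ∀ p ∈ Finset.range ⌈(x : ℝ) ^ (((f i).natDegree : ℝ) / U)⌉₊, p.Prime →
            ¬ ((p : ℤ) ∣ (f i).eval (n : ℤ)))).filter (fun n : ℕ => ∀ i,
          Odd (ArithmeticFunction.cardFactors (((f i).eval (n : ℤ)).toNat)))).card : ℕ) : ℝ) := by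
  intro η hη
  obtain ⟨_, hC0⟩ := IsBatemanHornSystem.hasBatemanHornConst_holds hf
  set m : ℝ := batemanHornConst f / ∏ i, ((f i).natDegree : ℝ) with hm
  have hm0 : 0 < m := div_pos hC0 (prod_pos fun i _ => by exact_mod_cast hf.natDegree_pos i)
  -- the common tolerance `τ = ε = η'/3`, `η' = min η 1`
  set η' : ℝ := min η 1 with hη'
  have hη'0 : 0 < η' := lt_min hη one_pos
  have hη'1 : η' ≤ 1 := min_le_right _ _
  have hη'η : η' ≤ η := min_le_left _ _
  set τ : ℝ := η' / 3 with hτ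
  have hτ0 : 0 < τ := by positivity
  have hτ1 : τ < 1 := by rw [hτ]; linarith
  have hup : 1 + τ ≤ (1 + η') * (1 - τ) := by rw [hτ]; nlinarith
  have hlo : (1 - η') * (1 + τ) ≤ 1 - τ := by rw [hτ]; nlinarith
  obtain ⟨U_R, hR⟩ := roughCard_calibration hf τ hτ0
  obtain ⟨U_D, hDU⟩ := hD τ hτ0
  refine ⟨max (max U_R U_D) 1, fun U hU => ?_⟩
  have hUR : U_R ≤ U := le_trans (le_trans (le_max_left _ _) (le_max_left _ _)) hU
  have hUD : U_D ≤ U := le_trans (le_trans (le_max_right _ _) (le_max_left _ _)) hU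
  have hU0 : 0 < U := by linarith [le_trans (le_max_right _ _) hU]
  filter_upwards [hR U hUR, hDU U hUD, eventually_ge_atTop 2] with x h2 h1 hx2
  have hX : (0 : ℝ) < x := by exact_mod_cast (by omega : 0 < x)
  have hK : (0 : ℝ) < 2 ^ k * (m * x) := by positivity
  have hid : (x : ℝ) * (m * Real.exp (-((k : ℝ) * Real.eulerMascheroniConstant)) * U ^ k) =
      2 ^ k * (m * x) * (U * Real.exp (-Real.eulerMascheroniConstant) / 2) ^ k := by
    have h := two_pow_mul_shareBase_pow k U
    calc (x : ℝ) * (m * Real.exp (-((k : ℝ) * Real.eulerMascheroniConstant)) * U ^ k)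
        = x * m * (Real.exp (-((k : ℝ) * Real.eulerMascheroniConstant)) * U ^ k) := by ring
      _ = x * m * ((2 : ℝ) ^ k * (U * Real.exp (-Real.eulerMascheroniConstant) / 2) ^ k) := by
          rw [h]
      _ = 2 ^ k * (m * x) * (U * Real.exp (-Real.eulerMascheroniConstant) / 2) ^ k := by ring
  rw [hid] at h2
  have h1' := h1
  -- reshape the coordinate band into `|c₁ * (R * L) - K * co| ≤ ε * (K * co)`
  have e1 : ∀ c₁ L R : ℝ, c₁ * L * R = c₁ * (R * L) := fun _ _ _ => by ring
  have e2 : ∀ co : ℝ, (2 : ℝ) ^ k * co * (m * x) = 2 ^ k * (m * x) * co := fun _ => by ring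
  rw [e1, e2] at h1'
  have key := share_of_coord_arith (Nat.cast_nonneg _) (Nat.cast_nonneg _) hK hτ0.le hτ1
    h1' h2 hup hlo
  exact key.trans (mul_le_mul_of_nonneg_right hη'η (Nat.cast_nonneg _))

/-- **`A_f ↔ D_f`** for every Bateman–Horn system `f`: the odd-sector share statement of the cruxes
`OddSectorShare*` for `f` is EQUIVALENT, given only the proved band, to "Bateman–Horn ratio
`c₁(log x)^k/(m x)` = parity ratio `2^k c_odd/#R`" in the iterated limit — no convergence of either
ratio is asserted, and the constant `(U e^{−γ}/2)^k` has disappeared. [folklore] -/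
theorem share_iff_coordinates {k : ℕ} {f : Fin k → ℤ[X]} (hf : IsBatemanHornSystem f) :
    (∀ η : ℝ, 0 < η → ∃ U₀ : ℝ, ∀ U : ℝ, U₀ ≤ U → ∀ᶠ x : ℕ in Filter.atTop,
      |(((((Finset.Icc 1 x).filter (fun n : ℕ => ∀ i, 0 < (f i).eval (n : ℤ) ∧
          ∀ p ∈ Finset.range ⌈(x : ℝ) ^ (((f i).natDegree : ℝ) / U)⌉₊, p.Prime →
            ¬ ((p : ℤ) ∣ (f i).eval (n : ℤ)))).filter (fun n : ℕ => ∀ i,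
          ArithmeticFunction.cardFactors (((f i).eval (n : ℤ)).toNat) = 1)).card : ℕ) : ℝ) *
          (U * Real.exp (-Real.eulerMascheroniConstant) / 2) ^ k -
        (((((Finset.Icc 1 x).filter (fun n : ℕ => ∀ i, 0 < (f i).eval (n : ℤ) ∧
          ∀ p ∈ Finset.range ⌈(x : ℝ) ^ (((f i).natDegree : ℝ) / U)⌉₊, p.Prime →
            ¬ ((p : ℤ) ∣ (f i).eval (n : ℤ)))).filter (fun n : ℕ => ∀ i,
          Odd (ArithmeticFunction.cardFactors (((f i).eval (n : ℤ)).toNat)))).card : ℕ) : ℝ)| ≤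
        η * (((((Finset.Icc 1 x).filter (fun n : ℕ => ∀ i, 0 < (f i).eval (n : ℤ) ∧
          ∀ p ∈ Finset.range ⌈(x : ℝ) ^ (((f i).natDegree : ℝ) / U)⌉₊, p.Prime →
            ¬ ((p : ℤ) ∣ (f i).eval (n : ℤ)))).filter (fun n : ℕ => ∀ i,
          Odd (ArithmeticFunction.cardFactors (((f i).eval (n : ℤ)).toNat)))).card : ℕ) : ℝ)) ↔
    (∀ ε : ℝ, 0 < ε → ∃ U₀ : ℝ, ∀ U : ℝ, U₀ ≤ U → ∀ᶠ x : ℕ in Filter.atTop,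
      |(((((Finset.Icc 1 x).filter (fun n : ℕ => ∀ i, 0 < (f i).eval (n : ℤ) ∧
          ∀ p ∈ Finset.range ⌈(x : ℝ) ^ (((f i).natDegree : ℝ) / U)⌉₊, p.Prime →
            ¬ ((p : ℤ) ∣ (f i).eval (n : ℤ)))).filter (fun n : ℕ => ∀ i,
          ArithmeticFunction.cardFactors (((f i).eval (n : ℤ)).toNat) = 1)).card : ℕ) : ℝ) *
          Real.log x ^ k *
          ((((Finset.Icc 1 x).filter (fun n : ℕ => ∀ i, 0 < (f i).eval (n : ℤ) ∧
            ∀ p ∈ Finset.range ⌈(x : ℝ) ^ (((f i).natDegree : ℝ) / U)⌉₊, p.Prime →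
              ¬ ((p : ℤ) ∣ (f i).eval (n : ℤ)))).card : ℕ) : ℝ) -
        (2 : ℝ) ^ k * (((((Finset.Icc 1 x).filter (fun n : ℕ => ∀ i, 0 < (f i).eval (n : ℤ) ∧
          ∀ p ∈ Finset.range ⌈(x : ℝ) ^ (((f i).natDegree : ℝ) / U)⌉₊, p.Prime →
            ¬ ((p : ℤ) ∣ (f i).eval (n : ℤ)))).filter (fun n : ℕ => ∀ i,
          Odd (ArithmeticFunction.cardFactors (((f i).eval (n : ℤ)).toNat)))).card : ℕ) : ℝ) *
          (batemanHornConst f / (∏ i, ((f i).natDegree : ℝ)) * x)| ≤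
        ε * ((2 : ℝ) ^ k * (((((Finset.Icc 1 x).filter (fun n : ℕ => ∀ i, 0 < (f i).eval (n : ℤ) ∧
          ∀ p ∈ Finset.range ⌈(x : ℝ) ^ (((f i).natDegree : ℝ) / U)⌉₊, p.Prime →
            ¬ ((p : ℤ) ∣ (f i).eval (n : ℤ)))).filter (fun n : ℕ => ∀ i,
          Odd (ArithmeticFunction.cardFactors (((f i).eval (n : ℤ)).toNat)))).card : ℕ) : ℝ) *
          (batemanHornConst f / (∏ i, ((f i).natDegree : ℝ)) * x))) :=
  ⟨coordinates_of_share hf, share_of_coordinates hf⟩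

end Coordinates

/-! ### §3 The cruxes BY NAME in coordinates -/

/-- **The crux `OddSectorShareNonlinear` in Bateman–Horn / parity coordinates.**  The route decl
`Theses.RoughParitySectors.OddSectorShareNonlinear` holds iff for every Bateman–Horn system `f` with
a member of degree `≥ 2` and every `ε > 0` there is `U₀` such that for every `U ≥ U₀`, eventually in
`x`, `|c₁·(log x)^k·#R_f(x,U) − 2^k·c_odd·(m·x)| ≤ ε·2^k·c_odd·(m·x)` (`m = C(f)/∏deg fᵢ`): the
Bateman–Horn ratio of `f` equals the all-odd-sector density ratio of its jointly rough values in the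
iterated limit — "BH-defect = parity-defect".  Uses only the proved band. [folklore] -/
theorem oddSectorShareNonlinear_iff_coordinates :
    Summit.Parity.BatemanHorn.Theses.RoughParitySectors.OddSectorShareNonlinear ↔
    ∀ (k : ℕ) (f : Fin k → Polynomial ℤ), IsBatemanHornSystem f → (∃ i, 2 ≤ (f i).natDegree) →
      ∀ ε : ℝ, 0 < ε → ∃ U₀ : ℝ, ∀ U : ℝ, U₀ ≤ U → ∀ᶠ x : ℕ in Filter.atTop,
      |(((((Finset.Icc 1 x).filter (fun n : ℕ => ∀ i, 0 < (f i).eval (n : ℤ) ∧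
          ∀ p ∈ Finset.range ⌈(x : ℝ) ^ (((f i).natDegree : ℝ) / U)⌉₊, p.Prime →
            ¬ ((p : ℤ) ∣ (f i).eval (n : ℤ)))).filter (fun n : ℕ => ∀ i,
          ArithmeticFunction.cardFactors (((f i).eval (n : ℤ)).toNat) = 1)).card : ℕ) : ℝ) *
          Real.log x ^ k *
          ((((Finset.Icc 1 x).filter (fun n : ℕ => ∀ i, 0 < (f i).eval (n : ℤ) ∧
            ∀ p ∈ Finset.range ⌈(x : ℝ) ^ (((f i).natDegree : ℝ) / U)⌉₊, p.Prime →
              ¬ ((p : ℤ) ∣ (f i).eval (n : ℤ)))).card : ℕ) : ℝ) -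
        (2 : ℝ) ^ k * (((((Finset.Icc 1 x).filter (fun n : ℕ => ∀ i, 0 < (f i).eval (n : ℤ) ∧
          ∀ p ∈ Finset.range ⌈(x : ℝ) ^ (((f i).natDegree : ℝ) / U)⌉₊, p.Prime →
            ¬ ((p : ℤ) ∣ (f i).eval (n : ℤ)))).filter (fun n : ℕ => ∀ i,
          Odd (ArithmeticFunction.cardFactors (((f i).eval (n : ℤ)).toNat)))).card : ℕ) : ℝ) *
          (batemanHornConst f / (∏ i, ((f i).natDegree : ℝ)) * x)| ≤
        ε * ((2 : ℝ) ^ k * (((((Finset.Icc 1 x).filter (fun n : ℕ => ∀ i, 0 < (f i).eval (n : ℤ) ∧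
          ∀ p ∈ Finset.range ⌈(x : ℝ) ^ (((f i).natDegree : ℝ) / U)⌉₊, p.Prime →
            ¬ ((p : ℤ) ∣ (f i).eval (n : ℤ)))).filter (fun n : ℕ => ∀ i,
          Odd (ArithmeticFunction.cardFactors (((f i).eval (n : ℤ)).toNat)))).card : ℕ) : ℝ) *
          (batemanHornConst f / (∏ i, ((f i).natDegree : ℝ)) * x)) :=
  ⟨fun h k f hf hd => Coordinates.coordinates_of_share hf (h k f hf hd),
    fun h k f hf hd => Coordinates.share_of_coordinates hf (h k f hf hd)⟩

/-- **The all-linear twin `OddSectorShareLinear` in coordinates** (same statement for systems with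
every `deg fᵢ ≤ 1`). [folklore] -/
theorem oddSectorShareLinear_iff_coordinates :
    Summit.Parity.BatemanHorn.Theses.RoughParitySectors.OddSectorShareLinear ↔
    ∀ (k : ℕ) (f : Fin k → Polynomial ℤ), IsBatemanHornSystem f → (∀ i, (f i).natDegree ≤ 1) →
      ∀ ε : ℝ, 0 < ε → ∃ U₀ : ℝ, ∀ U : ℝ, U₀ ≤ U → ∀ᶠ x : ℕ in Filter.atTop,
      |(((((Finset.Icc 1 x).filter (fun n : ℕ => ∀ i, 0 < (f i).eval (n : ℤ) ∧
          ∀ p ∈ Finset.range ⌈(x : ℝ) ^ (((f i).natDegree : ℝ) / U)⌉₊, p.Prime →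
            ¬ ((p : ℤ) ∣ (f i).eval (n : ℤ)))).filter (fun n : ℕ => ∀ i,
          ArithmeticFunction.cardFactors (((f i).eval (n : ℤ)).toNat) = 1)).card : ℕ) : ℝ) *
          Real.log x ^ k *
          ((((Finset.Icc 1 x).filter (fun n : ℕ => ∀ i, 0 < (f i).eval (n : ℤ) ∧
            ∀ p ∈ Finset.range ⌈(x : ℝ) ^ (((f i).natDegree : ℝ) / U)⌉₊, p.Prime →
              ¬ ((p : ℤ) ∣ (f i).eval (n : ℤ)))).card : ℕ) : ℝ) -
        (2 : ℝ) ^ k * (((((Finset.Icc 1 x).filter (fun n : ℕ => ∀ i, 0 < (f i).eval (n : ℤ) ∧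
          ∀ p ∈ Finset.range ⌈(x : ℝ) ^ (((f i).natDegree : ℝ) / U)⌉₊, p.Prime →
            ¬ ((p : ℤ) ∣ (f i).eval (n : ℤ)))).filter (fun n : ℕ => ∀ i,
          Odd (ArithmeticFunction.cardFactors (((f i).eval (n : ℤ)).toNat)))).card : ℕ) : ℝ) *
          (batemanHornConst f / (∏ i, ((f i).natDegree : ℝ)) * x)| ≤
        ε * ((2 : ℝ) ^ k * (((((Finset.Icc 1 x).filter (fun n : ℕ => ∀ i, 0 < (f i).eval (n : ℤ) ∧
          ∀ p ∈ Finset.range ⌈(x : ℝ) ^ (((f i).natDegree : ℝ) / U)⌉₊, p.Prime →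
            ¬ ((p : ℤ) ∣ (f i).eval (n : ℤ)))).filter (fun n : ℕ => ∀ i,
          Odd (ArithmeticFunction.cardFactors (((f i).eval (n : ℤ)).toNat)))).card : ℕ) : ℝ) *
          (batemanHornConst f / (∏ i, ((f i).natDegree : ℝ)) * x)) :=
  ⟨fun h k f hf hd => Coordinates.coordinates_of_share hf (h k f hf hd),
    fun h k f hf hd => Coordinates.share_of_coordinates hf (h k f hf hd)⟩

end Summit.Parity.BatemanHorn.Cruxes.OddSectorShareNonlinear.Birth
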